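import Mathlib
import HarnessLib
import Summits.Parity.GeneralizedHardyLittlewood.Theorems.DilatedChowla.Negative.DilatedChowlaMirrorDefs

/-!
# `DilatedChowla` (stmt-Parity-13319): the load-bearing hypotheses `c ≠ 0` and `n ≠ n'`

Two `_false_without_` records for the crux `LiouvilleMAD.DilatedChowla` (route LiouvilleMAD, rank-4
node), in the factored notation of `DilatedChowlaMirrorDefs` (`S c n n' M = Σ_{m∈(M,2M]} λ(mn+c)λ(mn'+c)`):

* `S_zero_one_four` — at shift `c = 0` the pair of dilations `(1, 4)` is degenerate:
  `λ(m)λ(4m) = λ(m)² = 1`, so `S 0 1 4 M = M`;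
  `not_dilatedChowlaWithShiftZero` — hence the crux with the exclusion `c ≠ 0` dropped is false
  (the docstring of the crux: "`c = 0` … excluded").
* `not_dilatedChowlaWithoutDistinct` — with `n ≠ n'` dropped the diagonal `S c n n M = M`
  (`S_self_eq`, no cancellation) refutes it likewise.

Both are elementary; they document which hypotheses any line must USE (a proof that never uses
`c ≠ 0`, or never uses `n ≠ n'`, proves a false statement).
-/

noncomputable section

namespace Summit.Parity.GeneralizedHardyLittlewood.Theorems.DilatedChowla.Negative

open Summit.Parity.GeneralizedHardyLittlewood.Theses.LiouvilleMAD
open Summit.Parity.GeneralizedHardyLittlewood.Theorems.DilatedTableChowla.Negative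
  (L L_natCast L_natCast_mul L_mul_self_of_pos)
open Finset

/-! ## §1 The shift `c = 0`: the degenerate pair `(1, 4)` -/

/-- `λ(4) = 1` (`4 = 2·2`, complete multiplicativity). -/
theorem L_four : L 4 = 1 := by
  have h : L ((2 : ℕ) * (2 : ℕ) : ℤ) = L (2 : ℕ) * L (2 : ℕ) := L_natCast_mul 2 2
  have h2 : L (2 : ℕ) * L (2 : ℕ) = 1 := L_mul_self_of_pos (by norm_num)
  have : ((2 : ℕ) * (2 : ℕ) : ℤ) = 4 := by norm_num
  rw [this] at h
  rw [h, h2]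

/-- At shift `0` the pencil sum of the dilations `(1, 4)` has no cancellation: `S 0 1 4 M = M`. -/
theorem S_zero_one_four (M : ℕ) : S 0 1 4 M = M := by
  unfold S
  calc ∑ m ∈ Ioc M (2 * M), L ((m : ℤ) * (1 : ℕ) + 0) * L ((m : ℤ) * (4 : ℕ) + 0)
      = ∑ _m ∈ Ioc M (2 * M), (1 : ℝ) := by
        refine sum_congr rfl fun m hm => ?_
        rw [mem_Ioc] at hm
        have hm0 : (0 : ℤ) < m := by exact_mod_cast (show 0 < m by omega)
        have e1 : (m : ℤ) * (1 : ℕ) + 0 = m := by push_cast; ring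
        have e2 : (m : ℤ) * (4 : ℕ) + 0 = (m : ℤ) * ((4 : ℕ) : ℤ) := by push_cast; ring
        rw [e1, e2, L_natCast_mul m 4]
        have h4 : L ((4 : ℕ) : ℤ) = 1 := by exact_mod_cast L_four
        rw [h4, mul_one, L_mul_self_of_pos hm0]
    _ = M := by simp; omega

/-- The crux with the exclusion `c ≠ 0` dropped (all shifts allowed). -/
def DilatedChowlaWithShiftZero : Prop :=
  ∀ c : ℤ, ∃ κ : ℝ, 0 < κ ∧ ∃ C : ℝ, ∀ M n n' : ℕ, 1 ≤ n → 1 ≤ n' → n ≠ n' →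
    n ≤ 2 * M → n' ≤ 2 * M → |S c n n' M| ≤ C * (M : ℝ) ^ (1 - κ)

/-- The shift-zero version implies the crux (it is a strengthening). -/
theorem dilatedChowla_of_withShiftZero (h : DilatedChowlaWithShiftZero) : DilatedChowla :=
  fun c _ => h c

/-- **`c ≠ 0` is load-bearing**: with the shift `c = 0` allowed the crux is false — at the pair of
dilations `(1, 4)` (admissible once `M ≥ 2`) the sum is exactly `M`, and `M ≤ C·M^{1−κ}` fails for
large `M`. -/
theorem not_dilatedChowlaWithShiftZero : ¬ DilatedChowlaWithShiftZero := by
  intro h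
  obtain ⟨κ, hκ, C, hC⟩ := h 0
  -- at every `M ≥ 2`: `M = |S 0 1 4 M| ≤ C M^{1-κ}`, i.e. `M^κ ≤ C`
  have key : ∀ M : ℕ, 2 ≤ M → (M : ℝ) ^ κ ≤ C := by
    intro M hM
    have hb := hC M 1 4 le_rfl (by norm_num) (by norm_num) (by omega) (by omega)
    rw [S_zero_one_four, Nat.abs_cast] at hb
    have hMpos : (0 : ℝ) < M := by exact_mod_cast (show 0 < M by omega)
    have hsplit : (M : ℝ) ^ κ * (M : ℝ) ^ (1 - κ) = M := by
      rw [← Real.rpow_add hMpos]; norm_num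
    have hpos : 0 < (M : ℝ) ^ (1 - κ) := Real.rpow_pos_of_pos hMpos _
    have hb' : (M : ℝ) ^ κ * (M : ℝ) ^ (1 - κ) ≤ C * (M : ℝ) ^ (1 - κ) := by
      calc (M : ℝ) ^ κ * (M : ℝ) ^ (1 - κ) = M := hsplit
        _ ≤ C * (M : ℝ) ^ (1 - κ) := hb
    exact le_of_mul_le_mul_right hb' hpos
  -- but `M^κ → ∞`
  have hC1 : (2 : ℝ) ^ κ ≤ C := by exact_mod_cast key 2 le_rfl
  have hCpos : 0 < C := lt_of_lt_of_le (Real.rpow_pos_of_pos (by norm_num) κ) hC1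
  -- choose `M` with `M^κ > C`: `M := ⌈(C + 1)^{1/κ}⌉₊ + 2`
  set x : ℝ := (C + 1) ^ (1 / κ) with hx
  have hx0 : 0 ≤ x := Real.rpow_nonneg (by linarith) _
  set M : ℕ := ⌈x⌉₊ + 2 with hMdef
  have hM2 : 2 ≤ M := by omega
  have hxM : x ≤ M := by
    have : x ≤ ⌈x⌉₊ := Nat.le_ceil x
    have h2 : (⌈x⌉₊ : ℝ) ≤ M := by rw [hMdef]; push_cast; linarith
    linarith
  have hMκ : C + 1 ≤ (M : ℝ) ^ κ := by
    calc C + 1 = x ^ κ := by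
          rw [hx, ← Real.rpow_mul (by linarith), one_div_mul_cancel hκ.ne', Real.rpow_one]
      _ ≤ (M : ℝ) ^ κ := Real.rpow_le_rpow hx0 hxM hκ.le
  have := key M hM2
  linarith

/-! ## §2 Distinct dilations `n ≠ n'` -/

/-- The crux with the exclusion `n ≠ n'` dropped. -/
def DilatedChowlaWithoutDistinct : Prop :=
  ∀ c : ℤ, c ≠ 0 → ∃ κ : ℝ, 0 < κ ∧ ∃ C : ℝ, ∀ M n n' : ℕ, 1 ≤ n → 1 ≤ n' →
    n ≤ 2 * M → n' ≤ 2 * M → |S c n n' M| ≤ C * (M : ℝ) ^ (1 - κ)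

/-- The version without `n ≠ n'` implies the crux (it is a strengthening). -/
theorem dilatedChowla_of_withoutDistinct (h : DilatedChowlaWithoutDistinct) : DilatedChowla :=
  fun c hc => by
    obtain ⟨κ, hκ, C, hC⟩ := h c hc
    exact ⟨κ, hκ, C, fun M n n' hn hn' _ hnM hn'M => hC M n n' hn hn' hnM hn'M⟩

/-- **`n ≠ n'` is load-bearing**: on the diagonal `n = n' = 1` (shift `c = 1`) the sum is exactly
`M` (`S_self_eq`), and `M ≤ C·M^{1−κ}` fails for large `M`. -/
theorem not_dilatedChowlaWithoutDistinct : ¬ DilatedChowlaWithoutDistinct := by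
  intro h
  obtain ⟨κ, hκ, C, hC⟩ := h 1 one_ne_zero
  have key : ∀ M : ℕ, 1 ≤ M → (M : ℝ) ^ κ ≤ C := by
    intro M hM
    have hb := hC M 1 1 le_rfl le_rfl (by omega) (by omega)
    rw [S_self_eq le_rfl (by positivity), Nat.abs_cast] at hb
    have hMpos : (0 : ℝ) < M := by exact_mod_cast (show 0 < M by omega)
    have hsplit : (M : ℝ) ^ κ * (M : ℝ) ^ (1 - κ) = M := by
      rw [← Real.rpow_add hMpos]; norm_num
    have hpos : 0 < (M : ℝ) ^ (1 - κ) := Real.rpow_pos_of_pos hMpos _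
    have hb' : (M : ℝ) ^ κ * (M : ℝ) ^ (1 - κ) ≤ C * (M : ℝ) ^ (1 - κ) := by
      calc (M : ℝ) ^ κ * (M : ℝ) ^ (1 - κ) = M := hsplit
        _ ≤ C * (M : ℝ) ^ (1 - κ) := hb
    exact le_of_mul_le_mul_right hb' hpos
  have hC1 : (1 : ℝ) ^ κ ≤ C := by exact_mod_cast key 1 le_rfl
  rw [Real.one_rpow] at hC1
  set x : ℝ := (C + 1) ^ (1 / κ) with hx
  have hx0 : 0 ≤ x := Real.rpow_nonneg (by linarith) _
  set M : ℕ := ⌈x⌉₊ + 1 with hMdef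
  have hM1 : 1 ≤ M := by omega
  have hxM : x ≤ M := by
    have : x ≤ ⌈x⌉₊ := Nat.le_ceil x
    have h2 : (⌈x⌉₊ : ℝ) ≤ M := by rw [hMdef]; push_cast; linarith
    linarith
  have hMκ : C + 1 ≤ (M : ℝ) ^ κ := by
    calc C + 1 = x ^ κ := by
          rw [hx, ← Real.rpow_mul (by linarith), one_div_mul_cancel hκ.ne', Real.rpow_one]
      _ ≤ (M : ℝ) ^ κ := Real.rpow_le_rpow hx0 hxM hκ.le
  have := key M hM1
  linarith

end Summit.Parity.GeneralizedHardyLittlewood.Theorems.DilatedChowla.Negative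

end
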